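import Literature.MathematicalPhysics.QuantumManyBody.PeriodicWeightedFormSpectrum
import Literature.MathematicalPhysics.QuantumManyBody.PeriodicFormCoreTrigPoly
import HarnessLib

/-!
# The periodic `C¹` core in momentum space for an abstract weight: energies as maximal-form energies,
# Bose-symmetric trigonometric polynomials

Topic `Literature/MathematicalPhysics/QuantumManyBody`, sequel of `PeriodicWeightedFormSpectrum.lean`;
abstract-weight twin of `PeriodicFormCoreTrigPoly.lean` (same statements and proofs, with the embedding
`formEmbedW hL hWm hW` of an auxiliary admissible weight `W` and the energy of an arbitrary measurable weight
`W'`). In the notation of the maximal form of the sequel files,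
`Q_{W'}(η) = ∑ₙ (∑ₚ (2πnₚ/L)²) |⟪eₙ, η⟫|² + ∫ (W' ∘ fromUnitTorusN L) |η|²` on `L²((ℝ/ℤ)^{3N})`:

* the dictionary for embedded core functions `ι(graphEmbedW Ψ)` (a.e. representative, Fourier coefficients,
  spectral kinetic energy `= ∫ |∇Ψ|²` [LSSY2005, (A.10)], potential energy against any weight);
* `periodicEnergyW_eq_maxFormW` — `periodicEnergyW W' Ψ = Q_{W'}(ι(graphEmbedW Ψ))`;
* `periodicGroundStateEnergyW_mul_le_maxFormW_core` — the core variational principle in torus form,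
  `E₀(W') ‖ιΨ‖² ≤ Q_{W'}(ιΨ)`;
* `exists_core_formEmbedW_eq_sum_smul`, `periodicGroundStateEnergyW_mul_le_maxFormW_sum_smul` — Bose-symmetric
  trigonometric polynomials are embedded core functions (embedding built with the free weight `W = 0`), hence
  `E₀(W') ‖P‖² ≤ Q_{W'}(P)` for them [ReedSimonIV1978, Thm. XIII.64].

The `W`-independent algebra (`tsum_weight_inner_smul`, `lintegral_weight_smul_sq`, plane-wave factorisation and
Bose symmetry of trigonometric polynomials) is imported from the pair file.

## References
* [ReedSimonIV1978] Reed–Simon IV, Thm. XIII.64.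
* [LSSY2005] Lieb–Seiringer–Solovej–Yngvason (2005), App. A, (A.10).
* B. Simon, J. Operator Theory 1 (1979) 37–47 [Simon1979Forms].
-/

noncomputable section

open MeasureTheory Filter Set WithLp Complex UnitAddTorus
open scoped ENNReal NNReal Topology ComplexConjugate InnerProductSpace

namespace Literature.MathematicalPhysics.QuantumManyBody.BoseGas

-- The measure on `ℝ/ℤ` is the Haar PROBABILITY measure, as in `PeriodicFormDomain.lean`.
attribute [local instance] formDomain_measureSpace formDomain_isProbabilityMeasure formDomain_isProbabilityMeasure_pi

variable {N : ℕ} {L : ℝ} {W : Config N → ℝ≥0∞}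

/-- Local notation for the Hilbert space `H = L²((ℝ/ℤ)^{3N})`. -/
local notation "L2T " N':max => Lp ℂ 2 (volume : Measure (UnitAddTorus (Fin N' × Fin 3)))

/-! ### The dictionary for core functions -/

section Dictionary

variable (hL : 0 < L) (hWm : Measurable W) (hW : ∫⁻ X in cellN N L, W X ≠ ⊤)

/-- The embedded class `ι(graphEmbedW Ψ)` of a core function, as a function on the torus: a.e.
`L^{3N/2} Ψ ∘ fromUnitTorusN`. [folklore] -/
theorem coeFn_formEmbedW_graphEmbedW (Ψ : periodicCore N L) :
    ∀ᵐ t ∂(volume : Measure (UnitAddTorus (Fin N × Fin 3))),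
      (formEmbedW hL hWm hW ⟨graphEmbedW hL hWm hW Ψ, graphEmbedW_mem_formDomainW hL hWm hW Ψ⟩ :
        UnitAddTorus (Fin N × Fin 3) → ℂ) t = (cellScale N L : ℂ) * (Ψ : Config N → ℂ) (fromUnitTorusN L t) := by
  have hΨ : ContDiff ℝ 1 (Ψ : Config N → ℂ) := Ψ.2.1
  have h := (Lp.coeFn_smul ((cellScale N L : ℝ) : ℂ)
    ((memLp_torusFunN_compFunW hL hWm hW hΨ (Sum.inl ())).toLp _)).and
    (memLp_torusFunN_compFunW hL hWm hW hΨ (Sum.inl ())).coeFn_toLp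
  filter_upwards [h] with t ht
  rw [formEmbedW_apply]
  change (compLpW hL hWm hW hΨ (Sum.inl ()) : UnitAddTorus (Fin N × Fin 3) → ℂ) t = _
  unfold compLpW
  rw [ht.1, Pi.smul_apply, ht.2]
  simp only [torusFunN, compFunW_val, smul_eq_mul]

/-- The Fourier coefficients of the embedded class: `⟪eₙ, ι(graphEmbedW Ψ)⟫ = L^{3N/2} ĉₙ(Ψ)`. [folklore] -/
theorem inner_mFourierLp_formEmbedW_graphEmbedW (Ψ : periodicCore N L) (n : Fin N × Fin 3 → ℤ) :
    ⟪(mFourierLp 2 n : L2T N),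
      formEmbedW hL hWm hW ⟨graphEmbedW hL hWm hW Ψ, graphEmbedW_mem_formDomainW hL hWm hW Ψ⟩⟫_ℂ =
      (cellScale N L : ℂ) * configFourierCoeff L (Ψ : Config N → ℂ) n := by
  rw [formEmbedW_apply]
  exact inner_mFourierLp_compLpW_val hL hWm hW Ψ.2.1 n

/-- **The spectral kinetic energy of the embedded class is the kinetic energy**:
`∑ₙ (2πn/L)² |⟪eₙ, ι(graphEmbedW Ψ)⟫|² = ∫_{[0,L)^{3N}} |∇Ψ|²`. [cite: LSSY2005, App. A (A.10)] -/
theorem tsum_kinetic_formEmbedW_graphEmbedW (Ψ : periodicCore N L) :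
    ∑' n : Fin N × Fin 3 → ℤ, ENNReal.ofReal (∑ p, (2 * Real.pi * (n p : ℝ) / L) ^ 2) *
        (‖⟪(mFourierLp 2 n : L2T N),
          formEmbedW hL hWm hW ⟨graphEmbedW hL hWm hW Ψ, graphEmbedW_mem_formDomainW hL hWm hW Ψ⟩⟫_ℂ‖₊ :
            ℝ≥0∞) ^ 2 =
      ∫⁻ X in cellN N L, kineticDensity (Ψ : Config N → ℂ) X := by
  have hsq : ∀ z : ℂ, ((‖(cellScale N L : ℂ) * z‖₊ : ℝ≥0∞)) ^ 2 =
      ENNReal.ofReal (cellScale N L ^ 2) * (‖z‖₊ : ℝ≥0∞) ^ 2 := fun z => by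
    rw [coe_nnnorm_sq_eq_ofReal, coe_nnnorm_sq_eq_ofReal, norm_mul, Complex.norm_real,
      Real.norm_of_nonneg (cellScale_nonneg N L), mul_pow, ENNReal.ofReal_mul (sq_nonneg _)]
  have hone : ENNReal.ofReal (cellScale N L ^ 2) * ((ENNReal.ofReal L ^ 3)⁻¹) ^ N = 1 := by
    rw [cellScale_sq hL.le, ← ofReal_inv_pow_three_pow hL N, ← ENNReal.ofReal_mul (by positivity),
      ← mul_pow, mul_inv_cancel₀ (pow_ne_zero 3 hL.ne'), one_pow, ENNReal.ofReal_one]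
  simp only [inner_mFourierLp_formEmbedW_graphEmbedW hL hWm hW Ψ, hsq]
  simp only [mul_left_comm _ (ENNReal.ofReal (cellScale N L ^ 2))]
  rw [ENNReal.tsum_mul_left, tsum_sq_mul_sq_configFourierCoeff hL Ψ.2.1 Ψ.2.2.1, ← mul_assoc, hone,
    one_mul]

/-- **The potential energy of the embedded class** against any measurable weight transported to the
torus: `∫ (W ∘ fromUnitTorusN) |ι(graphEmbedW Ψ)|² = ∫_{[0,L)^{3N}} W |Ψ|²`. [folklore] -/
theorem lintegral_pot_formEmbedW_graphEmbedW (Ψ : periodicCore N L) {W' : Config N → ℝ≥0∞}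
    (hW'm : Measurable W') :
    ∫⁻ t, W' (fromUnitTorusN L t) *
        (‖(formEmbedW hL hWm hW ⟨graphEmbedW hL hWm hW Ψ, graphEmbedW_mem_formDomainW hL hWm hW Ψ⟩ :
          UnitAddTorus (Fin N × Fin 3) → ℂ) t‖₊ : ℝ≥0∞) ^ 2 =
      ∫⁻ X in cellN N L, W' X * (‖(Ψ : Config N → ℂ) X‖₊ : ℝ≥0∞) ^ 2 := by
  have hΨc : Continuous (Ψ : Config N → ℂ) := Ψ.2.1.continuous
  have hG : Measurable fun X : Config N => W' X * (‖(Ψ : Config N → ℂ) X‖₊ : ℝ≥0∞) ^ 2 :=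
    hW'm.mul ((hΨc.measurable.nnnorm.coe_nnreal_ennreal).pow_const 2)
  have hsq : ∀ z : ℂ, ((‖(cellScale N L : ℂ) * z‖₊ : ℝ≥0∞)) ^ 2 =
      ENNReal.ofReal (cellScale N L ^ 2) * (‖z‖₊ : ℝ≥0∞) ^ 2 := fun z => by
    rw [coe_nnnorm_sq_eq_ofReal, coe_nnnorm_sq_eq_ofReal, norm_mul, Complex.norm_real,
      Real.norm_of_nonneg (cellScale_nonneg N L), mul_pow, ENNReal.ofReal_mul (sq_nonneg _)]
  have hone : ENNReal.ofReal (cellScale N L ^ 2) * ((ENNReal.ofReal L ^ 3)⁻¹) ^ N = 1 := by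
    rw [cellScale_sq hL.le, ← ofReal_inv_pow_three_pow hL N, ← ENNReal.ofReal_mul (by positivity),
      ← mul_pow, mul_inv_cancel₀ (pow_ne_zero 3 hL.ne'), one_pow, ENNReal.ofReal_one]
  calc _ = ∫⁻ t, ENNReal.ofReal (cellScale N L ^ 2) *
        (W' (fromUnitTorusN L t) * (‖(Ψ : Config N → ℂ) (fromUnitTorusN L t)‖₊ : ℝ≥0∞) ^ 2) := by
        refine lintegral_congr_ae ((coeFn_formEmbedW_graphEmbedW hL hWm hW Ψ).mono fun t ht => ?_)
        dsimp only
        rw [ht, hsq]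
        ring
    _ = ENNReal.ofReal (cellScale N L ^ 2) * (((ENNReal.ofReal L ^ 3)⁻¹) ^ N *
          ∫⁻ X in cellN N L, W' X * (‖(Ψ : Config N → ℂ) X‖₊ : ℝ≥0∞) ^ 2) := by
        rw [lintegral_const_mul' _ _ ENNReal.ofReal_ne_top, lintegral_fromUnitTorusN hL hG]
    _ = _ := by rw [← mul_assoc, hone, one_mul]

/-- **The energy of a trial state is the maximal-form energy of its embedded class**:
`periodicEnergyW W' Ψ = ∑ₙ (2πn/L)² |⟪eₙ, ιΨ⟫|² + ∫ (W' ∘ fromUnitTorusN) |ιΨ|²` for every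
measurable weight `W'` (the embedding `ι` may be built with any auxiliary admissible weight `W`).
[cite: LSSY2005, App. A (A.10)] -/
theorem periodicEnergyW_eq_maxFormW {W' : Config N → ℝ≥0∞} (hW'm : Measurable W') (Ψ : PeriodicTrialState N L) :
    periodicEnergyW W' Ψ =
      ∑' n : Fin N × Fin 3 → ℤ, ENNReal.ofReal (∑ p, (2 * Real.pi * (n p : ℝ) / L) ^ 2) *
          (‖⟪(mFourierLp 2 n : L2T N),
            formEmbedW hL hWm hW ⟨graphEmbedW hL hWm hW ⟨Ψ.ψ, Ψ.mem_periodicCore⟩,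
              graphEmbedW_mem_formDomainW hL hWm hW _⟩⟫_ℂ‖₊ : ℝ≥0∞) ^ 2 +
        ∫⁻ t, W' (fromUnitTorusN L t) *
          (‖(formEmbedW hL hWm hW ⟨graphEmbedW hL hWm hW ⟨Ψ.ψ, Ψ.mem_periodicCore⟩,
              graphEmbedW_mem_formDomainW hL hWm hW _⟩ : UnitAddTorus (Fin N × Fin 3) → ℂ) t‖₊ : ℝ≥0∞) ^ 2 := by
  rw [tsum_kinetic_formEmbedW_graphEmbedW hL hWm hW ⟨Ψ.ψ, Ψ.mem_periodicCore⟩,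
    lintegral_pot_formEmbedW_graphEmbedW hL hWm hW ⟨Ψ.ψ, Ψ.mem_periodicCore⟩
      hW'm]
  unfold periodicEnergyW
  rw [← lintegral_add_left (measurable_kineticDensity_any Ψ.ψ)]

end Dictionary

/-! ### The core variational principle in torus form -/

section Variational

variable (hL : 0 < L) (hWm : Measurable W) (hW : ∫⁻ X in cellN N L, W X ≠ ⊤)



/-- **The core variational principle in torus form.** For every core function `Ψ` (`C¹`, periodic,
Bose-symmetric) and every measurable weight `W'`,
`E₀(W') · ‖ιΨ‖² ≤ ∑ₙ (2πn/L)² |⟪eₙ, ιΨ⟫|² + ∫ (W' ∘ fromUnitTorusN) |ιΨ|²`, `ιΨ = ι(graphEmbedW Ψ)`: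
either `ιΨ = 0`, or `Ψ/‖ιΨ‖` is a periodic trial state whose energy bounds `E₀(W')`.
[cite: ReedSimonIV1978, Thm. XIII.64] -/
theorem periodicGroundStateEnergyW_mul_le_maxFormW_core {W' : Config N → ℝ≥0∞} (hW'm : Measurable W')
    (Ψ : periodicCore N L) :
    periodicGroundStateEnergyW W' L *
        ENNReal.ofReal (‖formEmbedW hL hWm hW ⟨graphEmbedW hL hWm hW Ψ, graphEmbedW_mem_formDomainW hL hWm hW Ψ⟩‖ ^ 2) ≤
      ∑' n : Fin N × Fin 3 → ℤ, ENNReal.ofReal (∑ p, (2 * Real.pi * (n p : ℝ) / L) ^ 2) *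
          (‖⟪(mFourierLp 2 n : L2T N),
            formEmbedW hL hWm hW ⟨graphEmbedW hL hWm hW Ψ, graphEmbedW_mem_formDomainW hL hWm hW Ψ⟩⟫_ℂ‖₊ : ℝ≥0∞) ^ 2 +
        ∫⁻ t, W' (fromUnitTorusN L t) *
          (‖(formEmbedW hL hWm hW ⟨graphEmbedW hL hWm hW Ψ, graphEmbedW_mem_formDomainW hL hWm hW Ψ⟩ :
              UnitAddTorus (Fin N × Fin 3) → ℂ) t‖₊ : ℝ≥0∞) ^ 2 := by
  set c : ℝ := ‖formEmbedW hL hWm hW ⟨graphEmbedW hL hWm hW Ψ, graphEmbedW_mem_formDomainW hL hWm hW Ψ⟩‖ with hc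
  rcases eq_or_lt_of_le (show 0 ≤ c from norm_nonneg _) with h0 | hpos
  · rw [← h0]
    simp
  -- normalise
  set Φ : periodicCore N L := ((c⁻¹ : ℝ) : ℂ) • Ψ with hΦ
  have hιΦ : formEmbedW hL hWm hW ⟨graphEmbedW hL hWm hW Φ, graphEmbedW_mem_formDomainW hL hWm hW Φ⟩ =
      ((c⁻¹ : ℝ) : ℂ) • formEmbedW hL hWm hW ⟨graphEmbedW hL hWm hW Ψ, graphEmbedW_mem_formDomainW hL hWm hW Ψ⟩ := by
    rw [← map_smul]
    congr 1
    apply Subtype.ext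
    simp only [hΦ, map_smul, SetLike.mk_smul_mk]
  have h1 : ‖formEmbedW hL hWm hW ⟨graphEmbedW hL hWm hW Φ, graphEmbedW_mem_formDomainW hL hWm hW Φ⟩‖ = 1 := by
    rw [hιΦ, norm_smul, Complex.norm_real, Real.norm_of_nonneg (inv_nonneg.2 hpos.le), ← hc,
      inv_mul_cancel₀ hpos.ne']
  have hE := periodicGroundStateEnergyW_le W' (PeriodicTrialState.ofCoreW hL hWm hW Φ h1)
  rw [periodicEnergyW_eq_maxFormW hL hWm hW hW'm] at hE
  have hcore : (⟨(PeriodicTrialState.ofCoreW hL hWm hW Φ h1).ψ,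
      (PeriodicTrialState.ofCoreW hL hWm hW Φ h1).mem_periodicCore⟩ : periodicCore N L) = Φ := rfl
  rw [hcore, hιΦ, tsum_weight_inner_smul, lintegral_weight_smul_sq, ← mul_add, Complex.norm_real,
    Real.norm_of_nonneg (inv_nonneg.2 hpos.le)] at hE
  -- multiply through by `c²`
  have hcc : ENNReal.ofReal (c ^ 2) * ENNReal.ofReal (c⁻¹ ^ 2) = 1 := by
    rw [← ENNReal.ofReal_mul (sq_nonneg _), ← mul_pow, mul_inv_cancel₀ hpos.ne', one_pow, ENNReal.ofReal_one]
  calc periodicGroundStateEnergyW W' L * ENNReal.ofReal (c ^ 2)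
      ≤ (ENNReal.ofReal (c⁻¹ ^ 2) * _) * ENNReal.ofReal (c ^ 2) := mul_le_mul_left hE _
    _ = _ := by rw [mul_comm, ← mul_assoc, hcc, one_mul]

end Variational

/-! ### Bose-symmetric trigonometric polynomials are embedded core functions -/

section TrigPoly

variable (hL : 0 < L) (hWm : Measurable W) (hW : ∫⁻ X in cellN N L, W X ≠ ⊤)


/-- **Bose-symmetric trigonometric polynomials are embedded core functions.** For a finite set of
frequencies `S` stable under the particle permutations and coefficients `a` invariant under them,
the core function `Ψ = L^{-3N/2} ∑_{n ∈ S} aₙ e^{2πi n·X/L}` has `ι(graphEmbedW Ψ) = ∑_{n ∈ S} aₙ eₙ`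
in `L²((ℝ/ℤ)^{3N})`. [folklore] -/
theorem exists_core_formEmbedW_eq_sum_smul {S : Finset (Fin N × Fin 3 → ℤ)} {a : (Fin N × Fin 3 → ℤ) → ℂ}
    (hS : ∀ (σ : Equiv.Perm (Fin N)) (n : Fin N × Fin 3 → ℤ), n ∈ S → (fun p => n (σ p.1, p.2)) ∈ S)
    (ha : ∀ (σ : Equiv.Perm (Fin N)) (n : Fin N × Fin 3 → ℤ), a (fun p => n (σ p.1, p.2)) = a n) :
    ∃ Ψ : periodicCore N L,
      formEmbedW hL hWm hW ⟨graphEmbedW hL hWm hW Ψ, graphEmbedW_mem_formDomainW hL hWm hW Ψ⟩ =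
        ∑ n ∈ S, a n • (mFourierLp 2 n : L2T N) := by
  set P : Config N → ℂ := fun X => ((cellScale N L)⁻¹ : ℂ) * ∑ n ∈ S, a n * cellWaveN L n X with hP
  have hPmem : P ∈ periodicCore N L := by
    refine ⟨?_, ?_, ?_⟩
    · exact contDiff_const.mul (ContDiff.sum fun n _ => contDiff_const.mul (contDiff_cellWaveN L n))
    · intro X i k
      simp only [hP, cellWaveN_periodic hL.ne' _ X i k]
    · intro σ X
      simp only [hP, sum_mul_cellWaveN_comp_perm hS ha σ X]
  refine ⟨⟨P, hPmem⟩, Lp.ext ?_⟩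
  have hsc : cellScale N L ≠ 0 := by
    rw [cellScale]; exact (Real.sqrt_pos.2 (by positivity)).ne'
  filter_upwards [coeFn_formEmbedW_graphEmbedW hL hWm hW ⟨P, hPmem⟩,
    Literature.Analysis.FunctionSpaces.HaarTorus.coeFn_sum_smul_mFourierLp S a] with t h1 h2
  rw [h1, h2]
  simp only [hP, cellWaveN, toUnitTorusN_fromUnitTorusN hL.ne', ← mul_assoc]
  rw [mul_inv_cancel₀ (by exact_mod_cast hsc), one_mul]

omit hWm hW in
/-- **The core variational principle for Bose-symmetric trigonometric polynomials**: for `L > 0`,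
`S`, `a` as above and every measurable weight `W'`, with `P = ∑_{n ∈ S} aₙ eₙ`,
`E₀(W') · ‖P‖² ≤ ∑ₙ (2πn/L)² |⟪eₙ, P⟫|² + ∫ (W' ∘ fromUnitTorusN) |P|²` (the embedding is built
with the free weight `W = 0`). [cite: ReedSimonIV1978, Thm. XIII.64] -/
theorem periodicGroundStateEnergyW_mul_le_maxFormW_sum_smul (hL : 0 < L) {W' : Config N → ℝ≥0∞} (hW'm : Measurable W')
    {S : Finset (Fin N × Fin 3 → ℤ)} {a : (Fin N × Fin 3 → ℤ) → ℂ}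
    (hS : ∀ (σ : Equiv.Perm (Fin N)) (n : Fin N × Fin 3 → ℤ), n ∈ S → (fun p => n (σ p.1, p.2)) ∈ S)
    (ha : ∀ (σ : Equiv.Perm (Fin N)) (n : Fin N × Fin 3 → ℤ), a (fun p => n (σ p.1, p.2)) = a n) :
    periodicGroundStateEnergyW W' L * ENNReal.ofReal (‖∑ n ∈ S, a n • (mFourierLp 2 n : L2T N)‖ ^ 2) ≤
      ∑' n : Fin N × Fin 3 → ℤ, ENNReal.ofReal (∑ p, (2 * Real.pi * (n p : ℝ) / L) ^ 2) *
          (‖⟪(mFourierLp 2 n : L2T N), ∑ m ∈ S, a m • (mFourierLp 2 m : L2T N)⟫_ℂ‖₊ : ℝ≥0∞) ^ 2 +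
        ∫⁻ t, W' (fromUnitTorusN L t) *
          (‖((∑ m ∈ S, a m • (mFourierLp 2 m : L2T N) : L2T N) : UnitAddTorus (Fin N × Fin 3) → ℂ) t‖₊ :
            ℝ≥0∞) ^ 2 := by
  have hv0 : Measurable (0 : Config N → ℝ≥0∞) := measurable_const
  have hW0 : ∫⁻ X in cellN N L, (0 : Config N → ℝ≥0∞) X ≠ ⊤ := by simp
  obtain ⟨Ψ, hΨ⟩ := exists_core_formEmbedW_eq_sum_smul hL hv0 hW0 hS ha
  rw [← hΨ]
  exact periodicGroundStateEnergyW_mul_le_maxFormW_core hL hv0 hW0 hW'm Ψ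

end TrigPoly
end Literature.MathematicalPhysics.QuantumManyBody.BoseGas

end
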